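import Literature.NumberTheory.Automorphic.AsaiAtOneOfAsaiHolomorphy
import Literature.NumberTheory.Automorphic.PairLFunctionBoundaryLandau
import Literature.NumberTheory.Automorphic.PairLFunctionBoundaryMoeglinWaldspurger
import Literature.NumberTheory.Automorphic.PairLFunctionPolesEqConjLandau
import HarnessLib

/-!
# Grbac–Shahidi 2015, Thm. 4.3 at `s = 1` from the holomorphy of the Asai `L`-functions and the
# Mœglin–Waldspurger continuation of `L^S(s, π × π̄)` ALONE: the Rankin–Selberg input by
# de la Vallée Poussin–Landau positivity, with the cross term continued by the Asai functions

Topic `NumberTheory/Automorphic`; namespace `Literature.NumberTheory.Automorphic`. Proof file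
(theorems only: no definition, no named fact, no instance), fifth sibling of `AsaiSignContinuation`
(the named fact `GrbacShahidi2015_partialAsaiL_at_one`: order `≥ -1` and non-vanishing of the partial
Asai `L`-functions of a cuspidal representation of `GL_N(𝔸_E)` at `s = 1`), after
`AsaiAtOneOfHolomorphy` (the fact from holomorphy `hHol` and a Rankin–Selberg hypothesis `hRS`),
`AsaiAtOneOfL2` (`hRS` from the `L²` facts (2.2), (2.2)', (2.3) of Jacquet–Shalika and multiplicity
one), `AsaiAtOneOfAsaiHolomorphy` (`hHol` from Grbac–Shahidi's Thm. 4.3 (1), (2)(a) in `L²_cusp`,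
hypothesis `hGS`).

## What is proved

* `GrbacShahidi2015_partialAsaiL_at_one_of_asaiHolomorphy_of_moeglinWaldspurger` (**main**) — the
  named fact follows from `hGS` (Grbac–Shahidi 2015, Thm. 4.3 (1), (2)(a): `s (s - 1) L^S(s, Π₀, As^±)`
  entire for cuspidal `Π₀ ≤ L²_cusp(GL_N(E) A_G \ GL_N(𝔸_E))`, and `L^S(s, Π₀, As^±)` entire unless
  `Π₀` is conjugate self-dual a.e. — VERBATIM the hypothesis of
  `GrbacShahidi2015_partialAsaiL_at_one_of_asaiHolomorphy_of_L2`) and **one** named fact of the tree,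
  `MoeglinWaldspurger1989_partialPairL_of_eq_conj` (Mœglin–Waldspurger 1989, Appendice,
  Corollaire (ii): `s (s - 1) L^S(s, π ⊗ π̄)` extends to an entire function), over every number field,
  in every rank, for every automorphic measure.  Compared with `…_of_asaiHolomorphy_of_L2` the four
  hypotheses `JacquetShalika1981_partialPairL_at_one_of_ne_conj`, `…_boundary_of_ne_one`,
  `…_pole_of_eq_conj` and `multiplicity_one_gl` are GONE.
* `CuspidalAutomorphicRepData.exists_largeSet_pairL_finite_of_asaiHolomorphy_of_MW` — the
  Rankin–Selberg input for a cuspidal `Π` on `GL_N(𝔸_E)` that is NOT conjugate self-dual a.e.: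
  at all large Asai data `(S, A)` the raw product `R(s) = L^{S_E}(s, A ⊗ A^c)` is multipliable and
  holomorphic on `{1 < Re s}` and tends to a finite NON-ZERO limit as `s → 1`, `Re s > 1` — from
  `hGS` and Corollaire (ii) only.

## The argument (why no Jacquet–Shalika fact is needed)

Grbac–Shahidi (proof of Thm. 4.3, `(∗∗)` p. 205–206, Remark 4.4) and Mok (§2.5) take the behaviour
of the Rankin–Selberg function `L(s, σ × σ^θ) = L(s, σ, r_A) L(s, σ, r_A ⊗ δ)` at `s = 1` from
Jacquet–Shalika: a simple pole if `σ^θ ≅ σ̃`, finite and NON-ZERO otherwise (the non-vanishing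
being Shahidi's).  The tree has meanwhile re-proved these inputs from the CONTINUATION of the
Rankin–Selberg functions by de la Vallée Poussin's positivity argument and Landau's lemma
(`PairLFunctionPolesRankNeLandau`, `PairLFunctionBoundaryLandau`,
`PairLFunctionBoundaryMoeglinWaldspurger`, `PairLFunctionPolesEqConjLandau`): for cuspidal `π`, `σ`
with Satake families `α`, `β`, if the cross term `L^S(s, α ⊗ β)` has an ENTIRE continuation `E` and
the diagonal terms `s (s - 1) L^S(s, α ⊗ ᾱ)`, `s (s - 1) L^S(s, β̄ ⊗ β)` have entire continuations,
then `E` does not vanish on `Re s = 1` (`partialPairL_continuation_apply_one_ne_zero`,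
`partialPairL_continuation_ne_zero_of_re_eq_one`: the Dirichlet series of `γ = α ⊞ β̄_z` has
non-negative coefficients, Landau's lemma, Newton's identities and `∑_v q_v^{-1} = ∞`).  In the
Asai situation the cross term for the pair `(Π₀, Π₀^c)` IS the product of the two Asai functions
(Mok's factorisation `partialPairL_smul_eq_partialAsaiL_mul`), so its entire continuation is
supplied by `hGS` itself — Thm. 4.3 (1), "`L(s, σ, r_A)` is entire" for `σ` not Galois self-dual,
for both signs — and only the diagonal continuations (Corollaire (ii) for `(Π₀, Π̄₀)` and for the
Galois conjugate `(U_c Π₀, \overline{U_c Π₀})`) remain as input.  In detail, for a cuspidal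
Borel–Jacquet datum `Π`, unitary a.e. and not conjugate self-dual a.e., with dictionary
`t_{Π,w} = q_w^z t_{Π₀,w}` (`Π₀ ≤ L²_cusp`, Borel–Jacquet 5.7, `Re z = 0` by unitarity), at a large
datum `(S, A)`: `R(s) = L^{S_E}(s - 2z, Π₀ × U_c Π₀)` (`partialPairL_eq_of_shift`,
`IsSatakeFamilyOf.galConj`), and

* if the `L²` family of `Π₀` is not conjugate self-dual a.e.: `E = H₊ H₋` with `H_±` the entire
  continuations of `L^S(s, Π₀, As^±)` (`hGS`, clause (1)) equals `L^{S_E}(s, Π₀ × U_c Π₀)` far to the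
  right (factorisation; the products converge there by Jacquet–Shalika's (2.1) in `L²`,
  `JacquetShalika1981_multipliable_partialPairL_holds`, and by `exists_multipliable_asaiEulerFactors`
  shifted, `asaiEulerFactor_eq_of_shift`), hence on `{1 < Re s}` (identity theorem,
  `eqOn_one_lt_re_of_eq_on_lt_re`); so `E(1 - 2z) ≠ 0` — at `s₀ = 1` if `z = 0`, on the line
  `Re s = 1` otherwise — and `R(s) → E(1 - 2z)` (`tendsto_partialPairL_of_shift'`);
* if it IS conjugate self-dual a.e.: then `z ≠ 0` (for `z = 0`, `A = t_{Π₀}` off `S_E` would make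
  `Π` conjugate self-dual a.e.), and off a finite set `t_{Π₀, cw} = t_{Π₀,w}⁻¹ = \bar t_{Π₀,w}`
  (`IsSatakeFamilyOf.map_inv_eq_map_conj`), so that `R(s) = L^{S_E}(s - 2z, Π₀ × Π̄₀)` at large `S`,
  finite and non-zero at the point `1 - 2z ≠ 1` of `Re s = 1` by
  `JacquetShalika1981_partialPairL_boundary_of_ne_one_of_eq_conj_of_MW` (Corollaire (ii) and
  de la Vallée Poussin's `3-4-1` inequality) — no Asai input at all.

For `Π` conjugate self-dual a.e. the simple pole of `R` at large data is
`exists_largeSet_pairL_pole_of_L2'` (`AsaiAtOneOfL2`) fed with (2.3) in the form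
`JacquetShalika1981_partialPairL_pole_of_eq_conj_of_moeglinWaldspurger` (Corollaire (ii) and Landau).
The assembly is then that of `GrbacShahidi2015_partialAsaiL_at_one_of_holomorphy_of_L2` (clause at the
enlarged datum by `exists_clause_partialAsaiL_at_one_of_hol_of_pairL`, transport down to `S` by
`exists_clause_partialAsaiL_at_one_of_subset`, holomorphy at every datum by `hol_of_asaiHolomorphyL2`).

What this does NOT give: `hGS` (Langlands–Shahidi theory on `U(N, N)` with Mok's endoscopic
classification, Grbac–Shahidi Thm. 4.1/4.3; requested as the named fact
`GrbacShahidi2015_partialAsaiL_holomorphy`, which a proving seat may not file, D-0026) and the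
Mœglin–Waldspurger continuation (the named fact `MoeglinWaldspurger1989_partialPairL_of_eq_conj` of
`PairLFunctionMeromorphicContinuation`).  After this file the named fact
`GrbacShahidi2015_partialAsaiL_at_one` is closed modulo exactly these two inputs.

## References

* N. Grbac, F. Shahidi, *Endoscopic transfer for unitary groups and holomorphy of Asai
  `L`-functions*, Pacific J. Math. 276 (2015), 185–211: Thm. 4.3 (pp. 186, 204) and its proof,
  pp. 204–206 (`(∗∗)`, Remark 4.4), §2.A p. 190. [GrbacShahidi2015]
* C. Mœglin, J.-L. Waldspurger, *Le spectre résiduel de `GL(n)`*, Ann. Sci. ÉNS (4) 22 (1989),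
  Appendice, Corollaire (ii), p. 667. [MoeglinWaldspurger1989]
* S. Gelbart, *When is an `L`-function non-vanishing in part of the critical strip?*, in: Harmonic
  Analysis, Group Representations, Automorphic Forms and Invariant Theory, World Scientific (2007),
  §2 ("the Rankin–Selberg generalization of de la Vallée Poussin"). [Gelbart2007Nonvanishing]
* H. L. Montgomery, R. C. Vaughan, *Multiplicative Number Theory I*, CUP (2007), §1.2 Thm. 1.7
  (Landau). [MontgomeryVaughan2007]
* J. Arthur, L. Clozel, *Simple algebras, base change, and the advanced theory of the trace formula*,
  Ann. of Math. Stud. 120 (1989), Ch. 1 §2.1 (`Π^σ`), Ch. 3 §2 (2.1)–(2.3). [ArthurClozelAMS120]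
* A. Borel, H. Jacquet, *Automorphic forms and automorphic representations*, Corvallis 1979, 4.6, 5.7.
  [BorelJacquetCorvallis1979]
* C. P. Mok, *Endoscopic classification of representations of quasi-split unitary groups*,
  Mem. Amer. Math. Soc. 235 (2015), no. 1108, §2.5 (factorisation before Thm. 2.5.4). [Mok2014]
-/

noncomputable section

open scoped Topology
open NumberField IsDedekindDomain Filter Polynomial MeasureTheory

namespace Literature.NumberTheory.Automorphic

open AdelicGroupData

/-! ### The Rankin–Selberg input for non-conjugate-self-dual `Π`, from `hGS` and Corollaire (ii) -/

section RankinSelberg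

variable {F E : Type} [Field F] [NumberField F] [Field E] [NumberField E] [Algebra F E]
  {N : ℕ} {hcpt : isCompact_glFiniteIntegralLevel N E}

/-- **`L^{S_E}(s, Π × Π^c)` for `Π` NOT conjugate self-dual: multipliable and holomorphic on
`{1 < Re s}`, finite and non-zero at `s = 1` along `Re s → 1⁺`, at all large Asai data — from
Grbac–Shahidi's holomorphy `hGS` and Mœglin–Waldspurger's Corollaire (ii) only** (module docstring).
For a quadratic `E/F` (`finrank F E = 2`, `c ≠ 1`), a cuspidal `Π` on `GL_N(𝔸_E)`, `N ≥ 1`, unitary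
a.e. and not conjugate self-dual a.e.: there is a finite set `S⋆` of places of `F` such that for
every Asai datum `(S, A)` with `S⋆ ⊆ S` the raw product `R(s) = L^{S_E}(s, A ⊗ A^c)` is multipliable
and holomorphic on `{1 < Re s}` and tends to some `r ≠ 0` as `s → 1`, `Re s > 1`.  The continuation
of the cross term `L^{S_E}(s, Π₀ × U_c Π₀) = L^S(s, Π₀, As⁺) L^S(s, Π₀, As⁻)` is the product of the
entire continuations given by `hGS` (Thm. 4.3 (1)); its non-vanishing on `Re s = 1` is de la Vallée
Poussin–Landau (`partialPairL_continuation_apply_one_ne_zero`,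
`partialPairL_continuation_ne_zero_of_re_eq_one`), the diagonal continuations being Corollaire (ii)
for `(Π₀, Π̄₀)` and `(\overline{U_c Π₀}, U_c Π₀)`; when the normalisation `Π₀` is conjugate self-dual
(then `Π = Π₀ ⊗ |det|^z` with `z ≠ 0`) the cross term is `L^{S_E}(s - 2z, Π₀ × Π̄₀)` and the point
`1 - 2z ≠ 1` is handled by `JacquetShalika1981_partialPairL_boundary_of_ne_one_of_eq_conj_of_MW`.
[cite: GrbacShahidi2015, Thm. 4.3 (1) and proof of Thm. 4.3, pp. 205–206, Remark 4.4]
[cite: MoeglinWaldspurger1989, Appendice, Corollaire (ii), p. 667] [cite: Gelbart2007Nonvanishing, §2]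
[cite: ArthurClozelAMS120, Ch. 3 §2 (2.1)] [cite: BorelJacquetCorvallis1979, 5.7] -/
theorem CuspidalAutomorphicRepData.exists_largeSet_pairL_finite_of_asaiHolomorphy_of_MW
    (hGS : ∀ (F E : Type) [Field F] [NumberField F] [Field E] [NumberField E] [Algebra F E]
      (c : E ≃ₐ[F] E), Module.finrank F E = 2 → c ≠ 1 →
      ∀ (N : ℕ) (μ : Measure (gl N E).automorphicQuotient) [(gl N E).IsAutomorphicMeasure μ]
        (P : CuspidalAutomorphicRepGL N E μ), 0 < N →
        ∀ (S : Set (HeightOneSpectrum (𝓞 F))) (A : SatakeFamily E) (η : ℤˣ), S.Finite →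
          IsSatakeFamilyOf P {w : HeightOneSpectrum (𝓞 E) | w.under (𝓞 F) ∈ S} A →
          (∀ w : HeightOneSpectrum (𝓞 E), w.under (𝓞 F) ∉ S → c • w = w →
            w.asIdeal.inertiaDeg (𝓞 F) = 2) →
          ∃ σ₀ : ℝ, 1 ≤ σ₀ ∧
            (∃ G : ℂ → ℂ, Differentiable ℂ G ∧
              ∀ s : ℂ, σ₀ < s.re → G s = s * (s - 1) * partialAsaiL S c A η s) ∧
            ((¬ ∀ᶠ w : HeightOneSpectrum (𝓞 E) in cofinite, A (c • w) = (A w).map (·⁻¹)) →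
              ∃ H : ℂ → ℂ, Differentiable ℂ H ∧
                ∀ s : ℂ, σ₀ < s.re → H s = partialAsaiL S c A η s))
    (hMW : ∀ (μ : Measure (gl N E).automorphicQuotient) [(gl N E).IsAutomorphicMeasure μ],
      MoeglinWaldspurger1989_partialPairL_of_eq_conj (n := N) (K := E) (μ := μ))
    (h2 : Module.finrank F E = 2) {c : E ≃ₐ[F] E} (hc : c ≠ 1) (hN : 0 < N)
    (π : CuspidalAutomorphicRepData N E hcpt)
    (hu : ∀ᶠ w : HeightOneSpectrum (𝓞 E) in cofinite, ∀ α : Multiset ℂ,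
      π.1.HasSatakeParamAt w α → ‖α.prod‖ = 1)
    (hπ : ¬ π.1.IsConjSelfDualAE c) :
    ∃ Sstar : Set (HeightOneSpectrum (𝓞 F)), Sstar.Finite ∧
      ∀ (S : Set (HeightOneSpectrum (𝓞 F))) (A : SatakeFamily E), Sstar ⊆ S →
        π.1.IsAsaiDatum c S A →
        (∀ s : ℂ, 1 < s.re →
          Multipliable fun w : {w : HeightOneSpectrum (𝓞 E) // w.under (𝓞 F) ∉ S} =>
            ((satakePairPolynomial (A w.1) (A (c • w.1))).eval
              ((w.1.residueCard : ℂ) ^ (-s)))⁻¹) ∧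
        DifferentiableOn ℂ
          (partialPairL {w : HeightOneSpectrum (𝓞 E) | w.under (𝓞 F) ∈ S} A (fun w => A (c • w)))
          {s : ℂ | 1 < s.re} ∧
        ∃ r : ℂ, r ≠ 0 ∧
          Tendsto
            (partialPairL {w : HeightOneSpectrum (𝓞 E) | w.under (𝓞 F) ∈ S} A (fun w => A (c • w)))
            (𝓝[{s : ℂ | 1 < s.re}] 1) (𝓝 r) := by
  classical
  haveI : NeZero N := ⟨hN.ne'⟩
  haveI := infinite_heightOneSpectrum E
  have hcc : c * c = 1 := AlgEquiv.mul_self_eq_one_of_finrank_eq_two h2 c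
  obtain ⟨μ, hμ⟩ := AdelicGroupData.exists_isAutomorphicMeasure_gl_holds (n := N) (K := E)
  haveI := hμ
  have hμG : IsGalInvariant F μ :=
    isGalInvariant_of_unique F (isAutomorphicMeasure_unique_smul_holds N E) μ
  obtain ⟨z, P, S₁, αP, hS₁, hαP, hdict⟩ :=
    CuspidalAutomorphicRepData.exists_satake_eq_cpow_mul_L2_holds μ π
  have hcinv : c⁻¹ = c := inv_eq_of_mul_eq_one_right hcc
  -- the Galois conjugate `U_c(Π₀)` and its Satake family `w ↦ t_{Π₀, c w}`
  set Pc : CuspidalAutomorphicRepGL N E μ := P.galConj F hμG c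
  have hβ₀ : IsSatakeFamilyOf Pc ((c • ·) ⁻¹' S₁) (fun w => αP (c • w)) := by
    have h := hαP.galConj F hμG c
    rw [hcinv] at h
    exact h
  -- the failure set of conjugate self-duality of the `L²` family, when finite (else unused)
  set B : Set (HeightOneSpectrum (𝓞 E)) :=
    if (∀ᶠ w : HeightOneSpectrum (𝓞 E) in cofinite, αP (c • w) = (αP w).map (·⁻¹)) then
      {w | ¬ αP (c • w) = (αP w).map (·⁻¹)} else ∅ with hB
  have hBfin : B.Finite := by
    by_cases h : ∀ᶠ w : HeightOneSpectrum (𝓞 E) in cofinite, αP (c • w) = (αP w).map (·⁻¹)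
    · simp only [hB, if_pos h]
      exact Filter.eventually_cofinite.mp h
    · simp only [hB, if_neg h]
      exact Set.finite_empty
  refine ⟨(fun w : HeightOneSpectrum (𝓞 E) => w.under (𝓞 F)) '' (S₁ ∪ B), (hS₁.union hBfin).image _,
    fun S A hSstar hSA => ?_⟩
  -- bookkeeping above the complement of `S`
  set SE : Set (HeightOneSpectrum (𝓞 E)) := {w | w.under (𝓞 F) ∈ S}
  have hSEfin : SE.Finite := finite_setOf_under_mem hSA.finite
  have hS₁SE : S₁ ⊆ SE := fun w hw => hSstar ⟨w, Or.inl hw, rfl⟩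
  have hBSE : B ⊆ SE := fun w hw => hSstar ⟨w, Or.inr hw, rfl⟩
  have hcS₁SE : (c • ·) ⁻¹' S₁ ⊆ SE := fun w hw => by
    show w.under (𝓞 F) ∈ S
    rw [← HeightOneSpectrum.under_algEquiv_smul F E c w]
    exact hSstar ⟨c • w, Or.inl hw, rfl⟩
  have hαSE : IsSatakeFamilyOf P SE αP := hαP.mono hS₁SE
  have hβSE : IsSatakeFamilyOf Pc SE (fun w => αP (c • w)) := hβ₀.mono hcS₁SE
  have hunder : ∀ w : HeightOneSpectrum (𝓞 E), w ∉ SE → w.under (𝓞 F) ∉ S := fun w hw => hw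
  have hunderc : ∀ w : HeightOneSpectrum (𝓞 E), w ∉ SE → (c • w).under (𝓞 F) ∉ S := fun w hw => by
    rw [HeightOneSpectrum.under_algEquiv_smul]
    exact hw
  have hinert : ∀ w : HeightOneSpectrum (𝓞 E), w.under (𝓞 F) ∉ S → c • w = w →
      w.asIdeal.inertiaDeg (𝓞 F) = 2 := fun w hw hcw => hSA.inertiaDeg_eq_two hw hcw
  -- the shift `t_Π = q^z t_{Π₀}` at `w` and at `c w`
  have hα : ∀ w ∉ SE, A w = (αP w).map (((w.residueCard : ℂ) ^ z) * ·) := fun w hw =>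
    (hdict w (fun h => hw (hS₁SE h)) (A w)).mp (hSA.hasSatakeParamAt (hunder w hw))
  have hβ : ∀ w ∉ SE, A (c • w) = (αP (c • w)).map (((w.residueCard : ℂ) ^ z) * ·) := by
    intro w hw
    have hcw : c • w ∉ S₁ := fun h => hw (hcS₁SE h)
    have := (hdict (c • w) hcw (A (c • w))).mp (hSA.hasSatakeParamAt (hunderc w hw))
    rwa [residueCard_smul F c w] at this
  -- `Re z = 0` by unitarity at one place outside `S_E`
  have hz : z.re = 0 := by
    have hev : ∀ᶠ w : HeightOneSpectrum (𝓞 E) in cofinite, w ∉ SE := hSEfin.compl_mem_cofinite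
    obtain ⟨w₀, hw₀u, hw₀⟩ := (hu.and hev).exists
    exact re_eq_zero_of_norm_prod_eq_one_of_shift hαSE hN hw₀ (hα w₀ hw₀)
      (hw₀u (A w₀) (hSA.hasSatakeParamAt (hunder w₀ hw₀)))
  have hzz : (z + z).re = 0 := by rw [Complex.add_re, hz, add_zero]
  have hre : ∀ s : ℂ, (s - (z + z)).re = s.re := fun s => by
    rw [Complex.sub_re, hzz, sub_zero]
  -- `R(s) = L^{S_E}(s - 2z, Π₀ × U_c(Π₀))`
  have hR : partialPairL SE A (fun w => A (c • w)) =
      fun s => partialPairL SE αP (fun w => αP (c • w)) (s - (z + z)) :=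
    partialPairL_eq_of_shift hα hβ
  have hRPhol : DifferentiableOn ℂ (partialPairL SE αP (fun w => αP (c • w))) {s : ℂ | 1 < s.re} :=
    differentiableOn_partialPairL_of_isSatakeFamilyOf P Pc hαSE hβSE
  -- `z = 0` is excluded when the `L²` family is conjugate self-dual a.e. (else `Π` would be)
  have hz_of_csd : (∀ᶠ w : HeightOneSpectrum (𝓞 E) in cofinite, αP (c • w) = (αP w).map (·⁻¹)) →
      z + z ≠ 0 := by
    intro hcsd hz0
    have hz' : z = 0 := add_self_eq_zero.mp hz0
    apply hπ
    have hev : ∀ᶠ w : HeightOneSpectrum (𝓞 E) in cofinite, w ∉ SE := hSEfin.compl_mem_cofinite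
    filter_upwards [hcsd, hev] with w hw hwS α β hαw hβw
    have hα0 : A w = αP w := by
      rw [hα w hwS, hz', Complex.cpow_zero]
      simp
    have hβ0 : A (c • w) = αP (c • w) := by
      rw [hβ w hwS, hz', Complex.cpow_zero]
      simp
    rw [π.1.hasSatakeParamAt_unique_holds hαw (hSA.hasSatakeParamAt (hunder w hwS)),
      π.1.hasSatakeParamAt_unique_holds hβw (hSA.hasSatakeParamAt (hunderc w hwS)), hα0, hβ0]
    exact hw
  refine ⟨fun s hs => ?_, ?_, ?_⟩
  · -- multipliability on `{1 < Re s}` ((2.1), `JacquetShalika1981_multipliable_partialPairL_holds`)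
    have hs' : 1 < (s - (z + z)).re := by rwa [hre]
    have key := JacquetShalika1981_multipliable_partialPairL_holds P Pc hαSE hβSE hs'
    refine key.congr fun w => ?_
    have h := congrFun (pairEulerFactor_eq_of_shift (β := fun w => A (c • w))
      (β₀ := fun w => αP (c • w)) hα hβ s) w
    exact h.symm
  · -- holomorphy on `{1 < Re s}` (Jacquet–Shalika I, Thm. (5.3))
    rw [hR]
    refine hRPhol.comp (differentiable_id.sub_const (z + z)).differentiableOn fun s hs => ?_
    show 1 < (s - (z + z)).re
    rw [hre]
    exact hs
  · -- the finite non-zero limit at `s = 1`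
    -- the diagonal continuations (Mœglin–Waldspurger, Corollaire (ii)) for `(Π₀, Π̄₀)`, `(Ū, U)`
    obtain ⟨G, hG, hGeq⟩ := (hMW μ) hN P P.conj (P.conj_conj).symm hSEfin hαSE hαSE.conj
    obtain ⟨G', hG', hG'eq⟩ := (hMW μ) hN Pc.conj Pc rfl hSEfin hβSE.conj hβSE
    by_cases hPcsd : ∀ᶠ w : HeightOneSpectrum (𝓞 E) in cofinite, αP (c • w) = (αP w).map (·⁻¹)
    · -- (b) `Π₀` conjugate self-dual a.e.: `z ≠ 0`, `R(s) = L^{S_E}(s - 2z, Π₀ × Π̄₀)`, point `1 - 2z ≠ 1`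
      have hz0 : z + z ≠ 0 := hz_of_csd hPcsd
      have hBeq : B = {w | ¬ αP (c • w) = (αP w).map (·⁻¹)} := by simp only [hB, if_pos hPcsd]
      have hgood : ∀ w ∉ SE, αP (c • w) = (αP w).map (starRingEnd ℂ) := by
        intro w hw
        have h1 : αP (c • w) = (αP w).map (·⁻¹) := by
          by_contra h
          exact hw (hBSE (by rw [hBeq]; exact h))
        rw [h1]
        exact hαP.map_inv_eq_map_conj fun h => hw (hS₁SE h)
      have hRP : partialPairL SE αP (fun w => αP (c • w)) =
          partialPairL SE αP (fun w => (αP w).map (starRingEnd ℂ)) := by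
        funext s
        unfold partialPairL
        exact tprod_congr fun w => by dsimp only; rw [hgood w.1 w.2]
      have hs₀ : ((1 : ℂ) - (z + z)).re = 1 := by rw [hre, Complex.one_re]
      have hs₁ : (1 : ℂ) - (z + z) ≠ 1 := fun h => hz0 (sub_eq_self.mp h)
      obtain ⟨r, hr, hT⟩ := JacquetShalika1981_partialPairL_boundary_of_ne_one_of_eq_conj_of_MW (hMW μ)
        hN P P.conj (P.conj_conj).symm hSEfin hαSE hαSE.conj hs₀ hs₁
      rw [← hRP] at hT
      exact ⟨r, hr, tendsto_partialPairL_of_shift' hα hβ hzz hT⟩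
    · -- (a) `Π₀` not conjugate self-dual a.e.: the cross term is continued by the Asai functions
      obtain ⟨σp, hσp, -, hncp⟩ := hGS F E c h2 hc N μ P hN S αP 1 hSA.finite hαSE hinert
      obtain ⟨σm, -, -, hncm⟩ := hGS F E c h2 hc N μ P hN S αP (-1) hSA.finite hαSE hinert
      obtain ⟨Hp, hHp, hHpL⟩ := hncp hPcsd
      obtain ⟨Hm, hHm, hHmL⟩ := hncm hPcsd
      -- the Asai products of `t_{Π₀}` converge far to the right (clause (i) for `Π`, shifted)
      obtain ⟨σ₁, hσ₁, hmulA⟩ := π.exists_multipliable_asaiEulerFactors h2 hN hSA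
      have hmulαP : ∀ (θ : ℤˣ) (s : ℂ), σ₁ < s.re →
          Multipliable fun v : {v : HeightOneSpectrum (𝓞 F) // v ∉ S} =>
            ((asaiLocalPolynomial c αP θ (placeAbove E v.1)).eval ((v.1.residueCard : ℂ) ^ (-s)))⁻¹ := by
        intro θ s hs
        have hs' : σ₁ < (s + (z + z)).re := by rw [Complex.add_re, hzz, add_zero]; exact hs
        have h := hmulA θ (s + (z + z)) hs'
        rw [asaiEulerFactor_eq_of_shift h2 (fun w hw => hα w hw) hinert θ (s + (z + z))] at h
        simpa only [add_sub_cancel_right] using h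
      -- `E = H₊ H₋` is entire and equals the cross term on `{1 < Re s}`
      set Ecross : ℂ → ℂ := fun s => Hp s * Hm s
      have hEd : Differentiable ℂ Ecross := hHp.mul hHm
      set σ : ℝ := max (max σp σm) σ₁
      have hσ1 : 1 ≤ σ := hσp.trans ((le_max_left _ _).trans (le_max_left _ _))
      have hEfar : ∀ s : ℂ, σ < s.re → Ecross s = partialPairL SE αP (fun w => αP (c • w)) s := by
        intro s hs
        have hsp : σp < s.re := lt_of_le_of_lt ((le_max_left _ _).trans (le_max_left _ _)) hs
        have hsm : σm < s.re := lt_of_le_of_lt ((le_max_right _ _).trans (le_max_left _ _)) hs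
        have hs₁ : σ₁ < s.re := lt_of_le_of_lt (le_max_right _ _) hs
        have hs1 : 1 < s.re := lt_of_le_of_lt hσ1 hs
        have hmulE : Multipliable fun w : {w : HeightOneSpectrum (𝓞 E) // w.under (𝓞 F) ∉ S} =>
            ((satakePairPolynomial (αP w.1) (αP (c • w.1))).eval ((w.1.residueCard : ℂ) ^ (-s)))⁻¹ :=
          JacquetShalika1981_multipliable_partialPairL_holds P Pc hαSE hβSE hs1
        have hfac := partialPairL_smul_eq_partialAsaiL_mul h2 hc S αP hinert hmulE (hmulαP 1 s hs₁)
          (hmulαP (-1) s hs₁)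
        show Hp s * Hm s = partialPairL SE αP (fun w => αP (c • w)) s
        rw [hHpL s hsp, hHmL s hsm]
        exact hfac.symm
      have hEeq : ∀ s : ℂ, 1 < s.re → Ecross s = partialPairL SE αP (fun w => αP (c • w)) s :=
        fun s hs => eqOn_one_lt_re_of_eq_on_lt_re hσ1 hEd.differentiableOn hRPhol hEfar hs
      by_cases hz0 : z + z = 0
      · -- `z = 0`: the point `s₀ = 1` (`partialPairL_continuation_apply_one_ne_zero`)
        have h1 : Ecross 1 ≠ 0 :=
          partialPairL_continuation_apply_one_ne_zero hN hN P Pc hSEfin hαSE hβSE hEd hEeq hG hGeq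
            hG' hG'eq
        refine ⟨Ecross 1, h1, ?_⟩
        have hR0 : partialPairL SE A (fun w => A (c • w)) =
            partialPairL SE αP (fun w => αP (c • w)) := by
          rw [hR]
          funext s
          rw [hz0, sub_zero]
        rw [hR0]
        have hcont : Tendsto Ecross (𝓝[{s : ℂ | 1 < s.re}] 1) (𝓝 (Ecross 1)) :=
          (hEd 1).continuousAt.tendsto.mono_left nhdsWithin_le_nhds
        exact hcont.congr' (by filter_upwards [self_mem_nhdsWithin] with s hs using hEeq s hs)
      · -- `z ≠ 0`: the point `1 - 2z ≠ 1` of `Re s = 1` (`partialPairL_continuation_ne_zero_of_re_eq_one`)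
        have hs₀ : ((1 : ℂ) - (z + z)).re = 1 := by rw [hre, Complex.one_re]
        have h1 : Ecross (1 - (z + z)) ≠ 0 :=
          partialPairL_continuation_ne_zero_of_re_eq_one hN P Pc hSEfin hαSE hβSE hEd hEeq hG hGeq
            hG' hG'eq hs₀
        have hT : Tendsto (partialPairL SE αP (fun w => αP (c • w)))
            (𝓝[{s : ℂ | 1 < s.re}] (1 - (z + z))) (𝓝 (Ecross (1 - (z + z)))) := by
          have hcont : Tendsto Ecross (𝓝[{s : ℂ | 1 < s.re}] (1 - (z + z)))
              (𝓝 (Ecross (1 - (z + z)))) :=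
            (hEd _).continuousAt.tendsto.mono_left nhdsWithin_le_nhds
          exact hcont.congr' (by filter_upwards [self_mem_nhdsWithin] with s hs using hEeq s hs)
        exact ⟨Ecross (1 - (z + z)), h1, tendsto_partialPairL_of_shift' hα hβ hzz hT⟩

end RankinSelberg

/-! ### The named fact from `hGS` and Corollaire (ii) -/

section Reduction

variable {F E : Type} [Field F] [NumberField F] [Field E] [NumberField E] [Algebra F E]
  {N : ℕ} {hcpt : isCompact_glFiniteIntegralLevel N E}

/-- **Grbac–Shahidi 2015, Thm. 4.3 at `s = 1` (the named fact `GrbacShahidi2015_partialAsaiL_at_one`)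
from the HOLOMORPHY of the Asai `L`-functions in `L²_cusp` and Mœglin–Waldspurger's Corollaire (ii)
— nothing else.** Hypotheses:

* `hGS` — Grbac–Shahidi 2015, Thm. 4.3 (1) and (2)(a), holomorphy clauses, for the partial Asai
  `L`-functions of both signs of the cuspidal `Π₀ ≤ L²_cusp(GL_N(E) A_G \ GL_N(𝔸_E))`, verbatim as in
  `GrbacShahidi2015_partialAsaiL_at_one_of_asaiHolomorphy_of_L2` (the statement requested as the named
  fact `GrbacShahidi2015_partialAsaiL_holomorphy`);
* `hMW` — the tree's NAMED FACT `MoeglinWaldspurger1989_partialPairL_of_eq_conj` (`s (s - 1) L^S(s, π ⊗ π̄)`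
  extends to an entire function), over every number field, in every rank, for every automorphic
  measure.

Proof: the assembly of `GrbacShahidi2015_partialAsaiL_at_one_of_holomorphy_of_L2` with holomorphy at
every datum from `CuspidalAutomorphicRepData.hol_of_asaiHolomorphyL2`, the simple pole of
`L^{S_E}(s, Π × Π^c)` for conjugate self-dual `Π` from `exists_largeSet_pairL_pole_of_L2'` fed with
`JacquetShalika1981_partialPairL_pole_of_eq_conj_of_moeglinWaldspurger` (Corollaire (ii) and Landau's
lemma), and its finite non-zero value otherwise from
`exists_largeSet_pairL_finite_of_asaiHolomorphy_of_MW` (Corollaire (ii), `hGS` and de la Vallée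
Poussin–Landau).  This is Grbac–Shahidi's order count `(∗∗)` at `s = 1` (proof of Thm. 4.3,
pp. 205–206, Remark 4.4) with the Rankin–Selberg input re-derived from continuations by positivity,
so that neither Jacquet–Shalika's (2.2), (2.3) nor Shahidi's non-vanishing nor multiplicity one is
invoked. [cite: GrbacShahidi2015, Thm. 4.3 and its proof, pp. 204–206, Remark 4.4]
[cite: MoeglinWaldspurger1989, Appendice, Corollaire (ii), p. 667] [cite: Gelbart2007Nonvanishing, §2]
[cite: BorelJacquetCorvallis1979, 4.6, 5.7] -/
theorem GrbacShahidi2015_partialAsaiL_at_one_of_asaiHolomorphy_of_moeglinWaldspurger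
    (hGS : ∀ (F E : Type) [Field F] [NumberField F] [Field E] [NumberField E] [Algebra F E]
      (c : E ≃ₐ[F] E), Module.finrank F E = 2 → c ≠ 1 →
      ∀ (N : ℕ) (μ : Measure (gl N E).automorphicQuotient) [(gl N E).IsAutomorphicMeasure μ]
        (P : CuspidalAutomorphicRepGL N E μ), 0 < N →
        ∀ (S : Set (HeightOneSpectrum (𝓞 F))) (A : SatakeFamily E) (η : ℤˣ), S.Finite →
          IsSatakeFamilyOf P {w : HeightOneSpectrum (𝓞 E) | w.under (𝓞 F) ∈ S} A →
          (∀ w : HeightOneSpectrum (𝓞 E), w.under (𝓞 F) ∉ S → c • w = w →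
            w.asIdeal.inertiaDeg (𝓞 F) = 2) →
          ∃ σ₀ : ℝ, 1 ≤ σ₀ ∧
            (∃ G : ℂ → ℂ, Differentiable ℂ G ∧
              ∀ s : ℂ, σ₀ < s.re → G s = s * (s - 1) * partialAsaiL S c A η s) ∧
            ((¬ ∀ᶠ w : HeightOneSpectrum (𝓞 E) in cofinite, A (c • w) = (A w).map (·⁻¹)) →
              ∃ H : ℂ → ℂ, Differentiable ℂ H ∧
                ∀ s : ℂ, σ₀ < s.re → H s = partialAsaiL S c A η s))
    (hMW : ∀ (E : Type) [Field E] [NumberField E] (N : ℕ)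
      (μ : Measure (gl N E).automorphicQuotient) [(gl N E).IsAutomorphicMeasure μ],
      MoeglinWaldspurger1989_partialPairL_of_eq_conj (n := N) (K := E) (μ := μ)) :
    GrbacShahidi2015_partialAsaiL_at_one := by
  intro F E _ _ _ _ _ c h2 hc N hcpt π hN hu S A η hSA
  classical
  -- the Rankin–Selberg input at all large data of `π`
  obtain ⟨Sstar, hSstar, hlarge⟩ : ∃ Sstar : Set (HeightOneSpectrum (𝓞 F)), Sstar.Finite ∧
      ∀ (S : Set (HeightOneSpectrum (𝓞 F))) (A : SatakeFamily E), Sstar ⊆ S →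
        π.1.IsAsaiDatum c S A →
        (∀ s : ℂ, 1 < s.re →
          Multipliable fun w : {w : HeightOneSpectrum (𝓞 E) // w.under (𝓞 F) ∉ S} =>
            ((satakePairPolynomial (A w.1) (A (c • w.1))).eval
              ((w.1.residueCard : ℂ) ^ (-s)))⁻¹) ∧
        DifferentiableOn ℂ
          (partialPairL {w : HeightOneSpectrum (𝓞 E) | w.under (𝓞 F) ∈ S} A (fun w => A (c • w)))
          {s : ℂ | 1 < s.re} ∧
        (π.1.IsConjSelfDualAE c → ∃ r : ℂ, r ≠ 0 ∧
          Tendsto (fun s => (s - 1) *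
              partialPairL {w : HeightOneSpectrum (𝓞 E) | w.under (𝓞 F) ∈ S} A
                (fun w => A (c • w)) s)
            (𝓝[{s : ℂ | 1 < s.re}] 1) (𝓝 r)) ∧
        (¬ π.1.IsConjSelfDualAE c → ∃ r : ℂ, r ≠ 0 ∧
          Tendsto
            (partialPairL {w : HeightOneSpectrum (𝓞 E) | w.under (𝓞 F) ∈ S} A (fun w => A (c • w)))
            (𝓝[{s : ℂ | 1 < s.re}] 1) (𝓝 r)) := by
    by_cases hπ : π.1.IsConjSelfDualAE c
    · obtain ⟨Sstar, hSstar, h⟩ := π.exists_largeSet_pairL_pole_of_L2'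
        (fun μ _ => JacquetShalika1981_partialPairL_pole_of_eq_conj_of_moeglinWaldspurger (hMW E N μ))
        hN hπ
      refine ⟨Sstar, hSstar, fun S A hSS hSA => ?_⟩
      obtain ⟨hm, hd, hp⟩ := h S A hSS hSA
      exact ⟨hm, hd, fun _ => hp, fun hn => absurd hπ hn⟩
    · obtain ⟨Sstar, hSstar, h⟩ :=
        π.exists_largeSet_pairL_finite_of_asaiHolomorphy_of_MW hGS (fun μ _ => hMW E N μ) h2 hc hN
          hu hπ
      refine ⟨Sstar, hSstar, fun S A hSS hSA => ?_⟩
      obtain ⟨hm, hd, hf⟩ := h S A hSS hSA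
      exact ⟨hm, hd, fun hp => absurd hp hπ, fun _ => hf⟩
  -- holomorphy at every datum of `π` from `hGS`
  have hHol : ∀ (S : Set (HeightOneSpectrum (𝓞 F))) (A : SatakeFamily E) (θ : ℤˣ),
      π.1.IsAsaiDatum c S A →
      ∃ σ₀ : ℝ, 1 ≤ σ₀ ∧ ∃ δ : ℝ, 0 < δ ∧ ∃ G : ℂ → ℂ,
        DifferentiableOn ℂ G ({s : ℂ | 1 < s.re} ∪ Metric.ball 1 δ) ∧
        (∀ s : ℂ, σ₀ < s.re → G s = (s - 1) * partialAsaiL S c A θ s) ∧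
        (¬ π.1.IsConjSelfDualAE c → G 1 = 0) := fun S A θ hSA =>
    CuspidalAutomorphicRepData.hol_of_asaiHolomorphyL2 hGS h2 hc π hN hu θ hSA
  -- the clause at the enlarged datum `(S ∪ S⋆, A)`
  have hS''fin : (S ∪ Sstar).Finite := hSA.finite.union hSstar
  have hSA'' : π.1.IsAsaiDatum c (S ∪ Sstar) A := hSA.mono Set.subset_union_left hS''fin
  have hdiff : ((S ∪ Sstar) \ S).Finite := hS''fin.subset fun _ hv => hv.1
  obtain ⟨hmulP, hRhol, hpole, hfin⟩ := hlarge (S ∪ Sstar) A Set.subset_union_right hSA''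
  obtain ⟨σ'', -, hmulA'', k'', δ'', G'', hk'', hδ'', hG'', hG''L, hG''1⟩ :=
    π.exists_clause_partialAsaiL_at_one_of_hol_of_pairL h2 hc hN hSA''
      (fun θ => hHol (S ∪ Sstar) A θ hSA'') hmulP hRhol hpole hfin η
  -- down to `(S, A)`: clause (i) at `S`, holomorphy at `S`, transport
  obtain ⟨σ₁, hσ₁, hmulA⟩ := π.exists_multipliable_asaiEulerFactors h2 hN hSA
  obtain ⟨σS, hσS, δS, hδS, GS, hGS', hGSL, -⟩ := hHol S A η hSA
  obtain ⟨σ, hσSσ, k, δ', G', hk, hδ', hG', hG'L, hG'1⟩ :=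
    exists_clause_partialAsaiL_at_one_of_subset Set.subset_union_left hdiff c A η (hmulA'' η) hσS
      hδS hGS' hGSL hk'' hδ'' hG'' hG''L hG''1
  refine ⟨max σ σ₁, hσS.trans (hσSσ.trans (le_max_left _ _)),
    fun s hs => hmulA η s (lt_of_le_of_lt (le_max_right _ _) hs), k, δ', G', hk, hδ', hG',
    fun s hs => hG'L s (lt_of_le_of_lt (le_max_left _ _) hs), hG'1⟩

end Reduction

end Literature.NumberTheory.Automorphic

end
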